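import Mathlib
import HarnessLib
import Summits.Langlands.Langlands.Theses.SkinnerWilesDefectOne
import Summits.Langlands.Langlands.Theorems.SkinnerWilesDefectOneSeedOfQuadraticBaseChangeSixFacts

/-!
# Line `dihedral-halfturn` for the crux `EisensteinProModularSeed` (stmt-Langlands-12920)
# — forward ladder G4 (ladder-down on the crux top), planner `fwd-ladder-Langlands-50`, 2026-08-17

THE LADDER (see `LADDER-EisensteinProModularSeed.md` in the crux directory).  The crux is read as the
member `SeedOn ⊤ OrientedOrd` of the two-parameter family `SeedOn Pop Ord` — `Pop` = the population of
ordered residual pairs `(χ̄_a, χ̄_b)` served, `Ord ∈ {OrientedOrd, HalfOrientedOrd}` = at how many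
places above `p` the ordinary line of the witness `r` must be CORRECTLY ORIENTED (unit-root quotient
`≡ χ̄_a`): all of them (the crux) or at least one (frames of parallel weight at every `v ∣ p` regardless).

* FLOOR (landed, p96064…p107514 + p95941/p103537/p106056; conditional on the route crux
  `QuadraticBaseChangeGalois` and six named facts): `SeedOn Descends OrientedOrd` — the crux on the
  DESCENDED pairs (ratio `χ̄_b/χ̄_a` extends to an odd character of `Γ_ℚ`), by import from `ℚ`
  (level-raised EISENSTEIN newform, REDUCIBLE `ρ̄_g`) + quadratic base change + twist
  (`seed_of_descends_of_quadraticBaseChangeGalois_sixFacts`; the cousin grafts S7a–f widen it by the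
  elliptic-type pairs with a modular cousin — not restated here, graftable verbatim).
* WHY THE FLOOR'S PROOF STOPS (located, landed): a restrict-twist import `r = ν ⊗ ρ'|_{Γ_F}` forces the
  residual ratio to be conjugation-INVARIANT or ANTI-INVARIANT (`ratio_dichotomy_of_restrictTwist`,
  `not_seedByRestrictTwist_of_generic`, Theorems/…SeedOfQuadraticBaseChangeDichotomy); invariant =
  descended = the floor; anti-invariant needs `ρ̄'` IRREDUCIBLE over `ℚ` and `F`-dihedral (`Ind φ̄`), and
  such an `r` is ordinary only at SPLIT `p` and then correctly oriented at EXACTLY ONE of the two places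
  above `p` (STRATEGY-CENSUS T0; Disproof §8B).  The oriented clause is what kills the dihedral source.
* THE RUNG (this line's `stub_dihedralHalfOrientedSeed`, theorem-grade in print): `SeedOn DihedralSplit
  HalfOrientedOrd` — for ANTI-INVARIANT pairs (`χ̄_b/χ̄_a = φ̄ᶜ/φ̄`, the `F`-dihedral residual type)
  at a prime `p > 3` SPLIT in `F`, the seed's conclusion VERBATIM except that the orientation inequality
  is demanded at ONE place above `p` (it then fails at the other).  Mechanism = the floor's own engine
  with the Eisenstein newform replaced by a CM NEWFORM `θ(φ)` of `F` LEVEL-RAISED at one rational prime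
  `q ≡ -1 (mod p)` INERT in `F` (`a_q(θ(φ)) = 0`, Ribet/Diamond–Taylor level raising; the `q`-new `g`
  is Steinberg at `q`, hence not CM by `F`, so `ρ_g|_{Γ_F}` is irreducible), then
  `QuadraticBaseChangeGalois` + twist by `ν' = χ̄_a/φ̄` + the landed S4/S5 dictionary; ordinarity at
  the two split places from `a_p(g) ≡ a_p(θ(φ)) = φ(𝔭_{v̄}) ∈ 𝒪ˣ`; orientation at exactly one place
  by the transport `ρ_g|_{D_{v̄}} ≅ ρ_g|_{D_v} ∘ Ad(c)`.  The ONE auxiliary place of the crux is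
  exactly what CM level raising consumes.
* GAP AFTER THE RUNG (named, no mechanism in any line or card): `stub_secondPlaceTurn` — re-orient
  at the conjugate place; by T0 no base-change / induction / twist source can, so this is the first point
  where a non-functorial existence theorem for genuinely-Bianchi ordinary eigenforms is needed — and the
  residue `stub_residueSeed` (ratio moved by `c` to something other than its inverse; anti-invariant
  pairs at inert/ramified `p` or `p = 3`): the heart, unchanged.

Composition `EisensteinProModularSeed_of`: by cases `Descends` (floor, PROVED here from the landed
theorem) / `DihedralSplit` (rung + turn) / residue.  Sorries live only in the five `stub_*`.
-/

set_option linter.dupNamespace false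
set_option linter.unusedVariables false

noncomputable section

namespace Summit.Langlands.Langlands.Cruxes.EisensteinProModularSeed.DihedralHalfturn.Special

open Summit.Langlands.Langlands.Theses.SkinnerWilesDefectOne
open Summit.Langlands.Langlands.Theorems.SkinnerWilesDefectOne.SeedOfQuadraticBaseChange
open Literature.NumberTheory.Automorphic Literature.NumberTheory.GaloisRepresentations
open Literature.NumberTheory.Automorphic.BigHeckeGLn
open NumberField IsDedekindDomain IsLocalRing Filter Field

/-! ## 0. Vocabulary of the ladder (readable names for the crux's own clauses; nothing new is posited) -/

/-- A population of ordered residual pairs: a predicate on the datum `(F, p, O, ρ₀)`. -/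
abbrev PopPred : Type 1 :=
  ∀ (F : Type) [Field F] [NumberField F] (p : ℕ) [Fact p.Prime] (O : ValuationSubring (PadicAlgCl p)),
    (absoluteGaloisGroup F →* Matrix.GeneralLinearGroup (Fin 2) O) → Prop

/-- An orientation demand on the witness: a predicate on `(F, p, r)`. -/
abbrev OrdPred : Type 1 :=
  ∀ (F : Type) [Field F] [NumberField F] (p : ℕ) [Fact p.Prime], FramedGaloisRep F (PadicAlgCl p) 2 → Prop

/-- The crux's ordinary-of-weight-`k`-exponent-`m` clause at `v` in the frame `Q` (verbatim). -/
def OrdClause {F : Type} [Field F] [NumberField F] {p : ℕ} [Fact p.Prime]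
    (r : FramedGaloisRep F (PadicAlgCl p) 2) (v : HeightOneSpectrum (𝓞 F)) (k m : ℕ)
    (Q : Matrix.GeneralLinearGroup (Fin 2) (PadicAlgCl p)) : Prop :=
  ∀ σ, (Q⁻¹ * r.toLocal v σ * Q).val 1 0 = 0 ∧
    (σ ∈ absInertia (v.adicCompletion F) →
      (Q⁻¹ * r.toLocal v σ * Q).val 1 1 ^ m = 1 ∧
      (Q⁻¹ * r.toLocal v σ * Q).val 0 0 ^ m =
        algebraMap (Padic p) (PadicAlgCl p)
          (((GaloisRep.cyclotomicCharacter (v.adicCompletion F) p σ).val : PadicInt p) : Padic p) ^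
            ((k - 1) * m))

/-- The crux's orientation inequality on a frame (verbatim): the ordinary line `Q e₀` reduces to the
global residual QUOTIENT line, i.e. the unit-root quotient character reduces to `χ̄_a`. -/
def Oriented {p : ℕ} [Fact p.Prime] (Q : Matrix.GeneralLinearGroup (Fin 2) (PadicAlgCl p)) : Prop :=
  Valued.v (Q.val 0 0) ≤ Valued.v (Q.val 1 0)

/-- The crux's hypothesis on `(ρ, ρ₀)` at `p` (verbatim): oriented-ordinary of one parallel weight and
`p`-distinguished at every `v ∣ p`. -/
def OrdHyp (F : Type) [Field F] [NumberField F] (p : ℕ) [Fact p.Prime]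
    (O : ValuationSubring (PadicAlgCl p)) (ρ : FramedGaloisRep F (PadicAlgCl p) 2)
    (ρ₀ : absoluteGaloisGroup F →* Matrix.GeneralLinearGroup (Fin 2) O) : Prop :=
  ∃ k : ℕ, 2 ≤ k ∧ ∃ m : ℕ, 0 < m ∧ ∀ v : HeightOneSpectrum (𝓞 F), (p : 𝓞 F) ∈ v.asIdeal →
    IsPDistinguishedAt ρ₀ v ∧ ∃ Q : Matrix.GeneralLinearGroup (Fin 2) (PadicAlgCl p),
      Oriented Q ∧ OrdClause ρ v k m Q

/-- The crux's congruence clause (verbatim): same ORDERED residual diagonal. -/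
def Congr {F : Type} [Field F] {p : ℕ} [Fact p.Prime] {O : ValuationSubring (PadicAlgCl p)}
    (r₀ ρ₀ : absoluteGaloisGroup F →* Matrix.GeneralLinearGroup (Fin 2) O) : Prop :=
  ∀ g, ((r₀ g).val 0 0 - (ρ₀ g).val 0 0 : O) ∈ maximalIdeal O ∧
    ((r₀ g).val 1 1 - (ρ₀ g).val 1 1 : O) ∈ maximalIdeal O

/-- The crux's level clause (verbatim): off `q` and `p`, residually unramified places are good. -/
def LevelClause {F : Type} [Field F] [NumberField F] {p : ℕ} [Fact p.Prime]
    {O : ValuationSubring (PadicAlgCl p)} (𝒰 : TameLevel 2 F p) (q : HeightOneSpectrum (𝓞 F))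
    (ρ₀ : absoluteGaloisGroup F →* Matrix.GeneralLinearGroup (Fin 2) O) : Prop :=
  ∀ v : HeightOneSpectrum (𝓞 F), v ≠ q → (p : 𝓞 F) ∉ v.asIdeal →
    (∀ 𝔓 ∈ v.primesAbove, ∀ σ ∈ 𝔓.inertia (absoluteGaloisGroup F),
      ((ρ₀ σ).val 0 0 - 1 : O) ∈ maximalIdeal O ∧ ((ρ₀ σ).val 1 1 - 1 : O) ∈ maximalIdeal O) →
    v ∉ 𝒰.bad

/-- ORIENTATION DEMAND "all places" (the crux's conclusion at `p`, verbatim). -/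
def OrientedOrd : OrdPred := fun F _ _ p _ r =>
  ∃ k : ℕ, 2 ≤ k ∧ ∃ m : ℕ, 0 < m ∧ ∀ v : HeightOneSpectrum (𝓞 F), (p : 𝓞 F) ∈ v.asIdeal →
    ∃ Q : Matrix.GeneralLinearGroup (Fin 2) (PadicAlgCl p), Oriented Q ∧ OrdClause r v k m Q

/-- ORIENTATION DEMAND "at least one place": ordinary frames of ONE parallel weight at every `v ∣ p`,
the orientation inequality at SOME `v₀ ∣ p`. -/
def HalfOrientedOrd : OrdPred := fun F _ _ p _ r =>
  ∃ k : ℕ, 2 ≤ k ∧ ∃ m : ℕ, 0 < m ∧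
    (∀ v : HeightOneSpectrum (𝓞 F), (p : 𝓞 F) ∈ v.asIdeal →
      ∃ Q : Matrix.GeneralLinearGroup (Fin 2) (PadicAlgCl p), OrdClause r v k m Q) ∧
    (∃ v₀ : HeightOneSpectrum (𝓞 F), (p : 𝓞 F) ∈ v₀.asIdeal ∧
      ∃ Q : Matrix.GeneralLinearGroup (Fin 2) (PadicAlgCl p), Oriented Q ∧ OrdClause r v₀ k m Q)

/-- **The graded family.**  `SeedOn Pop Ord`: for every datum of the crux whose residual pair lies in
`Pop`, a witness `(𝒰, r, r₀, q)` as in the crux with the orientation demand `Ord`. -/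
def SeedOn (Pop : PopPred) (Ord : OrdPred) : Prop :=
  ∀ (F : Type) [Field F] [NumberField F], IsTotallyComplex F → Module.finrank ℚ F = 2 →
    ∀ (p : ℕ) [Fact p.Prime], p ≠ 2 → ∀ (O : ValuationSubring (PadicAlgCl p)),
    O = (Valued.v : Valuation (PadicAlgCl p) NNReal).valuationSubring →
    ∀ (ρ : FramedGaloisRep F (PadicAlgCl p) 2) (ρ₀ : absoluteGaloisGroup F →* Matrix.GeneralLinearGroup (Fin 2) O),
    ρ.toGaloisRep.IsIrreducible → (∀ᶠ v in cofinite, ρ.IsUnramifiedAt v) →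
    ρ.HasUpperTriangularIntegralModel ρ₀ → OrdHyp F p O ρ ρ₀ → Pop F p O ρ₀ →
    ∃ (𝒰 : TameLevel 2 F p) (r : FramedGaloisRep F (PadicAlgCl p) 2)
      (r₀ : absoluteGaloisGroup F →* Matrix.GeneralLinearGroup (Fin 2) O) (q : HeightOneSpectrum (𝓞 F)),
      r.toGaloisRep.IsIrreducible ∧ 𝒰.IsPadicallyAutomorphic r ∧ r.HasUpperTriangularIntegralModel r₀ ∧
      Congr r₀ ρ₀ ∧ Ord F p r ∧ LevelClause 𝒰 q ρ₀

/-! ### Populations -/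

/-- Everything (the crux's population). -/
def Top : PopPred := fun _ _ _ _ _ _ _ => True

/-- DESCENDED pairs (the floor's population, = hypothesis of the landed
`seed_of_descends_of_quadraticBaseChangeGalois_sixFacts`): the residual ratio extends to an ODD
continuous unit-valued character `η` of `Γ_ℚ`. -/
def Descends : PopPred := fun F _ _ p _ O ρ₀ =>
  ∃ η : absoluteGaloisGroup ℚ →ₜ* (PadicAlgCl p)ˣ,
    (∀ τ, Valued.v ((η τ : (PadicAlgCl p)ˣ) : PadicAlgCl p) = 1) ∧
    (∀ σ : absoluteGaloisGroup F,
      Valued.v (((η (absGaloisRestrict ℚ F σ) : (PadicAlgCl p)ˣ) : PadicAlgCl p) *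
          ((ρ₀ σ).val 0 0 : PadicAlgCl p) - ((ρ₀ σ).val 1 1 : PadicAlgCl p)) < 1) ∧
    (∀ c : absoluteGaloisGroup ℚ, IsComplexConjugation (Rat.castHom ℝ) c →
      Valued.v (((η c : (PadicAlgCl p)ˣ) : PadicAlgCl p) + 1) < 1)

/-- `p` SPLITS in `F`: two distinct places above `p` (for `F` imaginary quadratic ⟺ `p𝒪_F = v v̄`). -/
def SplitsAt (F : Type) [Field F] [NumberField F] (p : ℕ) : Prop :=
  ∃ v₁ v₂ : HeightOneSpectrum (𝓞 F), v₁ ≠ v₂ ∧ (p : 𝓞 F) ∈ v₁.asIdeal ∧ (p : 𝓞 F) ∈ v₂.asIdeal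

/-- ANTI-INVARIANT (F-dihedral) pairs in solvable form: for a complex conjugation `τ ∈ Γ_ℚ` there is
a continuous unit-valued `φ : Γ_F → ℚ̄_pˣ` with `χ̄_b(σ)·φ̄(σ) = χ̄_a(σ)·φ̄(σ^τ)` — i.e. the residual
ratio is `φ̄ᶜ/φ̄`, so `χ̄_a ⊕ χ̄_b = ν̄' ⊗ (Ind_F^ℚ φ̄)|_{Γ_F}` with `ν̄' = χ̄_a/φ̄`. (Every anti-invariant
ratio of odd order has this form; the 2-primary obstruction is left in the residue.) -/
def AntiCoboundary : PopPred := fun F _ _ p _ O ρ₀ =>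
  ∃ τ : absoluteGaloisGroup ℚ, IsComplexConjugation (Rat.castHom ℝ) τ ∧
    ∃ φ : absoluteGaloisGroup F →ₜ* (PadicAlgCl p)ˣ,
      (∀ σ, Valued.v ((φ σ : (PadicAlgCl p)ˣ) : PadicAlgCl p) = 1) ∧
      ∀ σ σ' : absoluteGaloisGroup F,
        absGaloisRestrict ℚ F σ' = τ * absGaloisRestrict ℚ F σ * τ⁻¹ →
        Valued.v (((φ σ' : (PadicAlgCl p)ˣ) : PadicAlgCl p) * ((ρ₀ σ).val 0 0 : PadicAlgCl p) -
            ((φ σ : (PadicAlgCl p)ˣ) : PadicAlgCl p) * ((ρ₀ σ).val 1 1 : PadicAlgCl p)) < 1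

/-- THE RUNG'S POPULATION: anti-invariant pairs at an (odd) prime `p` split in `F`. -/
def DihedralSplit : PopPred := fun F _ _ p _ O ρ₀ =>
  SplitsAt F p ∧ AntiCoboundary F p O ρ₀

/-- THE RESIDUE'S POPULATION: neither descended nor dihedral-split. -/
def Residue : PopPred := fun F _ _ p _ O ρ₀ =>
  ¬ Descends F p O ρ₀ ∧ ¬ DihedralSplit F p O ρ₀

/-! ## 1. The crux is the top of the family -/

theorem seedOn_top_orientedOrd_iff : SeedOn Top OrientedOrd ↔ EisensteinProModularSeed := by
  constructor
  · intro h F _ _ hF hdeg p _ hp2 O hO ρ ρ₀ hirr hunr hmod hord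
    obtain ⟨𝒰, r, r₀, q, h1, h2, h3, h4, h5, h6⟩ :=
      h F hF hdeg p hp2 O hO ρ ρ₀ hirr hunr hmod hord trivial
    exact ⟨𝒰, r, r₀, q, h1, h2, h3, h4, h5, h6⟩
  · intro h F _ _ hF hdeg p _ hp2 O hO ρ ρ₀ hirr hunr hmod hord _
    obtain ⟨𝒰, r, r₀, q, h1, h2, h3, h4, h5, h6⟩ := h F hF hdeg p hp2 O hO ρ ρ₀ hirr hunr hmod hord
    exact ⟨𝒰, r, r₀, q, h1, h2, h3, h4, h5, h6⟩

/-- Monotonicity in the population. -/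
theorem seedOn_mono {Pop Pop' : PopPred} {Ord : OrdPred}
    (hle : ∀ (F : Type) [Field F] [NumberField F] (p : ℕ) [Fact p.Prime] (O : ValuationSubring (PadicAlgCl p))
      (ρ₀ : absoluteGaloisGroup F →* Matrix.GeneralLinearGroup (Fin 2) O), Pop' F p O ρ₀ → Pop F p O ρ₀)
    (h : SeedOn Pop Ord) : SeedOn Pop' Ord :=
  fun F _ _ hF hdeg p _ hp2 O hO ρ ρ₀ hirr hunr hmod hord hpop =>
    h F hF hdeg p hp2 O hO ρ ρ₀ hirr hunr hmod hord (hle F p O ρ₀ hpop)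

/-- ON-PATH: every oriented seed on a population with a place above `p` is a half-oriented seed; in
particular the crux implies the rung (`dihedralHalfOrientedSeed_of_crux`). -/
theorem seedOn_halfOriented_of_oriented {Pop : PopPred}
    (hplace : ∀ (F : Type) [Field F] [NumberField F] (p : ℕ) [Fact p.Prime] (O : ValuationSubring (PadicAlgCl p))
      (ρ₀ : absoluteGaloisGroup F →* Matrix.GeneralLinearGroup (Fin 2) O), Pop F p O ρ₀ →
      ∃ v₀ : HeightOneSpectrum (𝓞 F), (p : 𝓞 F) ∈ v₀.asIdeal)
    (h : SeedOn Pop OrientedOrd) : SeedOn Pop HalfOrientedOrd := by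
  intro F _ _ hF hdeg p _ hp2 O hO ρ ρ₀ hirr hunr hmod hord hpop
  obtain ⟨𝒰, r, r₀, q, h1, h2, h3, h4, ⟨k, hk, m, hm, hfr⟩, h6⟩ :=
    h F hF hdeg p hp2 O hO ρ ρ₀ hirr hunr hmod hord hpop
  obtain ⟨v₀, hv₀⟩ := hplace F p O ρ₀ hpop
  refine ⟨𝒰, r, r₀, q, h1, h2, h3, h4, ⟨k, hk, m, hm, ?_, ?_⟩, h6⟩
  · intro v hv
    obtain ⟨Q, _, hQ⟩ := hfr v hv
    exact ⟨Q, hQ⟩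
  · obtain ⟨Q, hQo, hQ⟩ := hfr v₀ hv₀
    exact ⟨v₀, hv₀, Q, hQo, hQ⟩

/-- **THE RUNG as a closed statement.** -/
def DihedralHalfOrientedSeed : Prop := SeedOn DihedralSplit HalfOrientedOrd

/-- ON-PATH (`Crux → Rung`, proved): the crux implies the rung. -/
theorem dihedralHalfOrientedSeed_of_crux (h : EisensteinProModularSeed) : DihedralHalfOrientedSeed := by
  have htop : SeedOn Top OrientedOrd := seedOn_top_orientedOrd_iff.2 h
  have hdi : SeedOn DihedralSplit OrientedOrd := seedOn_mono (fun F _ _ p _ O ρ₀ _ => trivial) htop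
  refine seedOn_halfOriented_of_oriented ?_ hdi
  intro F _ _ p _ O ρ₀ hpop
  obtain ⟨⟨v₁, v₂, _, hv₁, _⟩, _⟩ := hpop
  exact ⟨v₁, hv₁⟩

/-! ## 2. The floor, PROVED from the landed theorem (conditional on the route crux
`QuadraticBaseChangeGalois` and the six named facts, exactly as landed) -/

/-- The six named Literature facts of the landed floor (`…SixFacts`), bundled. -/
def FloorFacts : Prop :=
  Literature.NumberTheory.EllipticCurves.BillereyMenares2016_thm22_exists_newform_odd ∧
  Literature.NumberTheory.EllipticCurves.Hida2000_thm326_exists_galoisRep ∧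
  Literature.NumberTheory.EllipticCurves.Hida2000_thm326_ordinary_unitRoot ∧
  Literature.NumberTheory.EllipticCurves.Hida2000_thm326_inertia_of_level ∧
  Literature.NumberTheory.Automorphic.bianchi_cuspidal_regularLAlgebraic_eigenclassExists ∧
  Literature.NumberTheory.Automorphic.algebraicWeightEigenclass_continuousPoint

/-- FLOOR = `SeedOn Descends OrientedOrd`, from the landed
`seed_of_descends_of_quadraticBaseChangeGalois_sixFacts` (no sorry; the rung family specialises to it). -/
theorem seedOn_descends_orientedOrd (hQ : QuadraticBaseChangeGalois) (hf : FloorFacts) :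
    SeedOn Descends OrientedOrd := by
  obtain ⟨f₁, f₂, f₃, f₄, e₁, e₂⟩ := hf
  intro F _ _ hF hdeg p _ hp2 O hO ρ ρ₀ hirr hunr hmod hord hpop
  obtain ⟨η, hU, hD, hodd⟩ := hpop
  obtain ⟨k, hk, m, hm, hkm⟩ := hord
  have hdist : ∀ v : HeightOneSpectrum (𝓞 F), (p : 𝓞 F) ∈ v.asIdeal → IsPDistinguishedAt ρ₀ v :=
    fun v hv => (hkm v hv).1
  obtain ⟨𝒰, r, r₀, q, h1, h2, h3, h4, h5, h6⟩ :=
    seed_of_descends_of_quadraticBaseChangeGalois_sixFacts hQ f₁ f₂ f₃ f₄ e₁ e₂ F hF hdeg p hp2 O hO ρ ρ₀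
      hunr hmod hdist η hU hD hodd
  exact ⟨𝒰, r, r₀, q, h1, h2, h3, h4, h5, h6⟩

/-! ## P. Forward-ladder probes (G4 / BC2–BC3): each `fail_if_success` must hold, i.e. the cheap
batteries must NOT close the implication; the trailing `sorry` only discharges the probe goal. -/

section probes

/-- WITNESS (F3): the rung family specialises to the landed floor — no sorry. -/
example (hQ : QuadraticBaseChangeGalois) (hf : FloorFacts) : SeedOn Descends OrientedOrd :=
  seedOn_descends_orientedOrd hQ hf

/-- ON-PATH (F4): `Crux → Rung` closes (by the proved lemma). -/
example : EisensteinProModularSeed → DihedralHalfOrientedSeed := dihedralHalfOrientedSeed_of_crux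

/-- REAL-STEP up (F4 / BC2): `Rung → Crux` must NOT close cheaply. -/
example : DihedralHalfOrientedSeed → EisensteinProModularSeed := by
  fail_if_success (first | exact? | (simpa [DihedralHalfOrientedSeed, SeedOn]) | (aesop (config := { terminal := true })))
  sorry

/-- REAL-STEP down (F4): `Floor → Rung` must NOT close cheaply (floor decl in scope). -/
example (hQ : QuadraticBaseChangeGalois) (hf : FloorFacts) (hfloor : SeedOn Descends OrientedOrd) :
    DihedralHalfOrientedSeed := by
  fail_if_success (first | exact? | (simpa [DihedralHalfOrientedSeed, SeedOn] using hfloor) | (aesop (config := { terminal := true })))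
  sorry

/-- VACUITY (A1–A6): the rung is not provable outright by the cheap batteries. -/
example : DihedralHalfOrientedSeed := by
  fail_if_success (first | exact? | (simp [DihedralHalfOrientedSeed, SeedOn, DihedralSplit, AntiCoboundary, SplitsAt]; done) | (aesop (config := { terminal := true })))
  sorry

/-- STUB PROBE: the gap stub's statement does not give the crux cheaply. -/
example (hturn : SeedOn DihedralSplit HalfOrientedOrd → SeedOn DihedralSplit OrientedOrd) :
    EisensteinProModularSeed := by
  fail_if_success (first | exact? | (aesop (config := { terminal := true })))
  sorry

/-- STUB PROBE: the residue stub's statement does not give the crux cheaply. -/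
example (hres : SeedOn Residue OrientedOrd) : EisensteinProModularSeed := by
  fail_if_success (first | exact? | (simpa [SeedOn, Residue] using hres) | (aesop (config := { terminal := true })))
  sorry

/-- STUB PROBE: the rung stub is not cheaply equivalent to the gap's conclusion. -/
example (hrung : SeedOn DihedralSplit HalfOrientedOrd) : SeedOn DihedralSplit OrientedOrd := by
  fail_if_success (first | exact? | (simpa [SeedOn] using hrung) | (aesop (config := { terminal := true })))
  sorry

/-- CONVERSE record (BC2, informational): `Crux → residue stub` closes (a sub-case). -/
example (h : EisensteinProModularSeed) : SeedOn Residue OrientedOrd :=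
  seedOn_mono (fun F _ _ p _ O ρ₀ _ => trivial) (seedOn_top_orientedOrd_iff.2 h)

end probes

end Summit.Langlands.Langlands.Cruxes.EisensteinProModularSeed.DihedralHalfturn.Special

end
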